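import Summits.Ventures.PercRepro.PuncturedLYMRecCert

/-!
# PercRepro — (SP) BY SUPERPOSITION, PART 15b: THE FIRST-ORDER RECURSIONS OF THE WEIGHTED CERTIFICATES (p10, gen 32)

With `P_a := C_{≤a}/C(n, j+1)` (the hypergeometric distribution function of `#(Y ∩ B)` for a uniform `(j+1)`-set `Y`,
`cdfQ`), the greedy certificates of PuncturedLYMRecCert satisfy the first-order recursions
`(n − 2j + a)·λ_a·sʸ_a + (j + 1 − a)·λ_{a−1}·sʸ_{a−1} = P_a` and `(n − 2j + a + 1)·μ_a·s'_a + (j + 1 − a)·μ_{a−1}·s'_{a−1} = P_a`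
(`lamRec_step`, `muRec_step`, with the initial cases `lamRec_step_zero`, `muRec_step_zero`), which follow from the two
binomial relations of the avoiding / through-point counts: `(n − 2j + a)·d(a)·sʸ_a = P_a` (`dFlux_mul_sQy`),
`(n − 2j + a)·a·sʸ_a = (j − a)(j + 1 − a)·sʸ_{a−1}` (`sQy_succ_rel`), `(n − 2j + a + 1)·g(a)·s'_a = (j − 1 − a)·P_a`
(`gDef_mul_sQ'`) and `(n − 2j + a + 1)·a·s'_a = (j − 1 − a)(j + 1 − a)·s'_{a−1}` (`sQ'_succ_rel`).
Nothing here asserts (SP) in general; the sums are PuncturedLYMRecSum2.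
-/

namespace PercRepro.PuncturedLYM

open Finset

variable {α : Type} [Fintype α]

/-! ### The two binomial relations of the avoiding counts -/

/-- `(n − 2j + a)·d(a)·sʸ_a = C_{≤a}/C(n, j+1)` for `a < j`, `2j + 1 ≤ n`. -/
theorem dFlux_mul_sQy {j a : ℕ} (ha : a < j) (hn : 2 * j + 1 ≤ Fintype.card α) :
    ((Fintype.card α : ℚ) - 2 * j + a) * dFlux α j a * sQy α j a =
      (cumCount (Fintype.card α) j a : ℚ) / ((Fintype.card α).choose (j + 1) : ℕ) := by
  have hmul := eDef_mul_eq (α := α) ha hn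
  obtain ⟨n, hn_def⟩ : ∃ n, Fintype.card α = n := ⟨_, rfl⟩
  rw [hn_def] at hn hmul ⊢
  unfold sQy
  rw [hn_def]
  have hτ : tauQ α j = ((n : ℚ) - j) / (n.choose (j + 1) : ℕ) := by
    unfold tauQ
    rw [hn_def]
  -- `sʸ_a·(n − j) = s_a·(n − 2j + a + 1)`
  have hrel := Nat.choose_mul_succ_eq (n - j - 1) (j - 1 - a)
  have e1 : n - j - 1 + 1 = n - j := by omega
  rw [e1] at hrel
  have e2 : n - j - (j - 1 - a) = n - 2 * j + a + 1 := by omega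
  rw [e2] at hrel
  have hrel' : ((j.choose a * (n - j - 1).choose (j - 1 - a) : ℕ) : ℚ) * ((n : ℚ) - j) =
      ((j.choose a * (n - j).choose (j - 1 - a) : ℕ) : ℚ) * ((n : ℚ) - 2 * j + a + 1) := by
    have := congrArg (Nat.cast (R := ℚ)) (congrArg (fun x => j.choose a * x) hrel)
    push_cast [Nat.cast_sub (by omega : j ≤ n), Nat.cast_sub (by omega : 2 * j ≤ n)] at this ⊢
    linarith
  have hja : (j : ℚ) - a ≠ 0 := by
    have : (a : ℚ) + 1 ≤ j := by exact_mod_cast ha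
    linarith
  have hm : (0 : ℚ) < (n : ℚ) - 2 * j + a := by
    have : (2 * j + 1 : ℚ) ≤ n := by exact_mod_cast hn
    have : (0 : ℚ) ≤ a := by positivity
    linarith
  have hN : (0 : ℚ) < (n : ℚ) - j := by
    have : (j : ℚ) + 1 ≤ n := by exact_mod_cast (by omega : j + 1 ≤ n)
    linarith
  have hC : (0 : ℚ) < (n.choose (j + 1) : ℕ) := by exact_mod_cast Nat.choose_pos (by omega)
  -- `s_a·d(a) = τ C_{≤a}/((n−2j+a)(n−2j+a+1))`
  have hsd : ((j.choose a * (n - j).choose (j - 1 - a) : ℕ) : ℚ) * dFlux α j a =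
      tauQ α j * (cumCount n j a : ℚ) / (((n : ℚ) - 2 * j + a) * ((n : ℚ) - 2 * j + a + 1)) := by
    have e : ((j.choose a * (n - j).choose (j - 1 - a) : ℕ) : ℚ) * dFlux α j a =
        ((j.choose a * (n - j).choose (j - 1 - a) : ℕ) : ℚ) / ((j : ℚ) - a) * eDef α j a := by
      unfold eDef
      field_simp
    rw [e, hmul]
  -- solve for `sʸ_a`
  have hsy : ((j.choose a * (n - j - 1).choose (j - 1 - a) : ℕ) : ℚ) =
      ((j.choose a * (n - j).choose (j - 1 - a) : ℕ) : ℚ) * ((n : ℚ) - 2 * j + a + 1) / ((n : ℚ) - j) := by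
    rw [eq_div_iff hN.ne']
    exact hrel'
  rw [hsy]
  have hm1 : (0 : ℚ) < (n : ℚ) - 2 * j + a + 1 := by linarith
  have e : ((n : ℚ) - 2 * j + a) * dFlux α j a *
      (((j.choose a * (n - j).choose (j - 1 - a) : ℕ) : ℚ) * ((n : ℚ) - 2 * j + a + 1) / ((n : ℚ) - j)) =
      (((n : ℚ) - 2 * j + a) * ((n : ℚ) - 2 * j + a + 1) / ((n : ℚ) - j)) *
        (((j.choose a * (n - j).choose (j - 1 - a) : ℕ) : ℚ) * dFlux α j a) := by ring
  rw [e, hsd, hτ]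
  field_simp

/-- `(n − 2j + a)·a·sʸ_a = (j − a)·(j + 1 − a)·sʸ_{a−1}` for `1 ≤ a ≤ j − 1`, `2j + 1 ≤ n`. -/
theorem sQy_succ_rel {j a : ℕ} (ha1 : 1 ≤ a) (ha : a < j) (hn : 2 * j + 1 ≤ Fintype.card α) :
    ((Fintype.card α : ℚ) - 2 * j + a) * a * sQy α j a = ((j : ℚ) - a) * ((j : ℚ) + 1 - a) * sQy α j (a - 1) := by
  obtain ⟨n, hn_def⟩ : ∃ n, Fintype.card α = n := ⟨_, rfl⟩
  rw [hn_def] at hn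
  unfold sQy
  rw [hn_def]
  -- `a·C(j, a) = (j + 1 − a)·C(j, a − 1)`
  have h1 := Nat.choose_succ_right_eq j (a - 1)
  have e1 : a - 1 + 1 = a := by omega
  have e1' : j - (a - 1) = j + 1 - a := by omega
  rw [e1, e1'] at h1
  -- `(n − 2j + a)·C(n − j − 1, j − 1 − a) = (j − a)·C(n − j − 1, j − a)`
  have h2 := Nat.choose_succ_right_eq (n - j - 1) (j - 1 - a)
  have e2 : j - 1 - a + 1 = j - a := by omega
  have e2' : n - j - 1 - (j - 1 - a) = n - 2 * j + a := by omega
  rw [e2, e2'] at h2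
  have e3 : j - 1 - (a - 1) = j - a := by omega
  rw [e3]
  have h1' : (j.choose a : ℚ) * a = (j.choose (a - 1) : ℚ) * ((j : ℚ) + 1 - a) := by
    have := congrArg (Nat.cast (R := ℚ)) h1
    push_cast [Nat.cast_sub (by omega : a ≤ j + 1)] at this
    linarith
  have h2' : ((n - j - 1).choose (j - a) : ℚ) * ((j : ℚ) - a) =
      ((n - j - 1).choose (j - 1 - a) : ℚ) * ((n : ℚ) - 2 * j + a) := by
    have := congrArg (Nat.cast (R := ℚ)) h2
    push_cast [Nat.cast_sub (by omega : a ≤ j), Nat.cast_sub (by omega : 2 * j ≤ n)] at this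
    linarith
  push_cast
  calc ((n : ℚ) - 2 * j + a) * a * ((j.choose a : ℚ) * ((n - j - 1).choose (j - 1 - a) : ℚ))
      = ((j.choose a : ℚ) * a) * (((n - j - 1).choose (j - 1 - a) : ℚ) * ((n : ℚ) - 2 * j + a)) := by ring
    _ = ((j.choose (a - 1) : ℚ) * ((j : ℚ) + 1 - a)) * (((n - j - 1).choose (j - a) : ℚ) * ((j : ℚ) - a)) := by
        rw [h1', h2']
    _ = ((j : ℚ) - a) * ((j : ℚ) + 1 - a) * ((j.choose (a - 1) : ℚ) * ((n - j - 1).choose (j - a) : ℚ)) := by ring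

/-- `(n − 2j + a + 1)·(g(a)/(j − 1 − a))·s'_a = C_{≤a}/C(n, j+1)` for `a + 2 ≤ j`, `2j + 1 ≤ n`, in the form
`(n − 2j + a + 1)·g(a)·s'_a = (j − 1 − a)·C_{≤a}/C(n, j+1)`. -/
theorem gDef_mul_sQ' {j a : ℕ} (ha : a + 2 ≤ j) (hn : 2 * j + 1 ≤ Fintype.card α) :
    ((Fintype.card α : ℚ) - 2 * j + a + 1) * gDef α j a * sQ' α j a =
      ((j : ℚ) - 1 - a) * ((cumCount (Fintype.card α) j a : ℚ) / ((Fintype.card α).choose (j + 1) : ℕ)) := by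
  have hmul := eDef_mul_eq (α := α) (a := a) (by omega) hn
  obtain ⟨n, hn_def⟩ : ∃ n, Fintype.card α = n := ⟨_, rfl⟩
  rw [hn_def] at hn hmul ⊢
  unfold sQ' gDef
  rw [hn_def]
  have hτ : tauQ α j = ((n : ℚ) - j) / (n.choose (j + 1) : ℕ) := by
    unfold tauQ
    rw [hn_def]
  -- `s_a·(j − 1 − a) = (n − j)·s'_a`
  have hrel := Nat.add_one_mul_choose_eq (n - j - 1) (j - 2 - a)
  have e1 : n - j - 1 + 1 = n - j := by omega
  have e2 : j - 2 - a + 1 = j - 1 - a := by omega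
  rw [e1, e2] at hrel
  have hrel' : ((n : ℚ) - j) * ((j.choose a * (n - j - 1).choose (j - 2 - a) : ℕ) : ℚ) =
      ((j.choose a * (n - j).choose (j - 1 - a) : ℕ) : ℚ) * ((j : ℚ) - 1 - a) := by
    have := congrArg (Nat.cast (R := ℚ)) (congrArg (fun x => j.choose a * x) hrel)
    push_cast [Nat.cast_sub (by omega : j ≤ n), Nat.cast_sub (by omega : a ≤ j - 1),
      Nat.cast_sub (by omega : 1 ≤ j)] at this ⊢
    linarith
  have hja : (j : ℚ) - a ≠ 0 := by
    have : (a : ℚ) + 2 ≤ j := by exact_mod_cast ha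
    linarith
  have hm : (0 : ℚ) < (n : ℚ) - 2 * j + a := by
    have : (2 * j + 1 : ℚ) ≤ n := by exact_mod_cast hn
    have : (0 : ℚ) ≤ a := by positivity
    linarith
  have hN : (0 : ℚ) < (n : ℚ) - j := by
    have : (j : ℚ) + 1 ≤ n := by exact_mod_cast (by omega : j + 1 ≤ n)
    linarith
  have hC : (0 : ℚ) < (n.choose (j + 1) : ℕ) := by exact_mod_cast Nat.choose_pos (by omega)
  have hsd : ((j.choose a * (n - j).choose (j - 1 - a) : ℕ) : ℚ) * dFlux α j a =
      tauQ α j * (cumCount n j a : ℚ) / (((n : ℚ) - 2 * j + a) * ((n : ℚ) - 2 * j + a + 1)) := by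
    have e : ((j.choose a * (n - j).choose (j - 1 - a) : ℕ) : ℚ) * dFlux α j a =
        ((j.choose a * (n - j).choose (j - 1 - a) : ℕ) : ℚ) / ((j : ℚ) - a) * eDef α j a := by
      unfold eDef
      field_simp
    rw [e, hmul]
  have hs' : ((j.choose a * (n - j - 1).choose (j - 2 - a) : ℕ) : ℚ) =
      ((j.choose a * (n - j).choose (j - 1 - a) : ℕ) : ℚ) * ((j : ℚ) - 1 - a) / ((n : ℚ) - j) := by
    rw [eq_div_iff hN.ne']
    linarith [hrel']
  rw [hs']
  have hm1 : (0 : ℚ) < (n : ℚ) - 2 * j + a + 1 := by linarith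
  have hj1 : (0 : ℚ) < (j : ℚ) - 1 - a := by
    have : (a : ℚ) + 2 ≤ j := by exact_mod_cast ha
    linarith
  have e : ((n : ℚ) - 2 * j + a + 1) * (((n : ℚ) - 2 * j + a) * dFlux α j a) *
      (((j.choose a * (n - j).choose (j - 1 - a) : ℕ) : ℚ) * ((j : ℚ) - 1 - a) / ((n : ℚ) - j)) =
      (((j : ℚ) - 1 - a) * ((n : ℚ) - 2 * j + a) * ((n : ℚ) - 2 * j + a + 1) / ((n : ℚ) - j)) *
        (((j.choose a * (n - j).choose (j - 1 - a) : ℕ) : ℚ) * dFlux α j a) := by ring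
  rw [e, hsd, hτ]
  have hm0 : ((n : ℚ) - 2 * j + a) * ((n : ℚ) - 2 * j + a + 1) ≠ 0 := mul_ne_zero hm.ne' hm1.ne'
  have e2 : ((j : ℚ) - 1 - a) * ((n : ℚ) - 2 * j + a) * ((n : ℚ) - 2 * j + a + 1) / ((n : ℚ) - j) *
      (((n : ℚ) - j) / (n.choose (j + 1) : ℕ) * (cumCount n j a : ℚ) / (((n : ℚ) - 2 * j + a) * ((n : ℚ) - 2 * j + a + 1))) =
      ((j : ℚ) - 1 - a) * ((cumCount n j a : ℚ) / (n.choose (j + 1) : ℕ)) *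
        ((((n : ℚ) - 2 * j + a) * ((n : ℚ) - 2 * j + a + 1)) / (((n : ℚ) - 2 * j + a) * ((n : ℚ) - 2 * j + a + 1))) *
        (((n : ℚ) - j) / ((n : ℚ) - j)) := by ring
  rw [e2, div_self hm0, div_self hN.ne', mul_one, mul_one]

/-- `(n − 2j + a + 1)·a·s'_a = (j − 1 − a)·(j + 1 − a)·s'_{a−1}` for `1 ≤ a`, `a + 2 ≤ j`, `2j + 1 ≤ n`. -/
theorem sQ'_succ_rel {j a : ℕ} (ha1 : 1 ≤ a) (ha : a + 2 ≤ j) (hn : 2 * j + 1 ≤ Fintype.card α) :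
    ((Fintype.card α : ℚ) - 2 * j + a + 1) * a * sQ' α j a =
      ((j : ℚ) - 1 - a) * ((j : ℚ) + 1 - a) * sQ' α j (a - 1) := by
  obtain ⟨n, hn_def⟩ : ∃ n, Fintype.card α = n := ⟨_, rfl⟩
  rw [hn_def] at hn
  unfold sQ'
  rw [hn_def]
  have h1 := Nat.choose_succ_right_eq j (a - 1)
  have e1 : a - 1 + 1 = a := by omega
  have e1' : j - (a - 1) = j + 1 - a := by omega
  rw [e1, e1'] at h1
  have h2 := Nat.choose_succ_right_eq (n - j - 1) (j - 2 - a)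
  have e2 : j - 2 - a + 1 = j - 2 - (a - 1) := by omega
  have e2' : n - j - 1 - (j - 2 - a) = n - 2 * j + a + 1 := by omega
  rw [e2, e2'] at h2
  have h1' : (j.choose a : ℚ) * a = (j.choose (a - 1) : ℚ) * ((j : ℚ) + 1 - a) := by
    have := congrArg (Nat.cast (R := ℚ)) h1
    push_cast [Nat.cast_sub (by omega : a ≤ j + 1)] at this
    linarith
  have e4 : j - 2 - (a - 1) = j - 1 - a := by omega
  have h2' : ((n - j - 1).choose (j - 1 - a) : ℚ) * ((j : ℚ) - 1 - a) =
      ((n - j - 1).choose (j - 2 - a) : ℚ) * ((n : ℚ) - 2 * j + a + 1) := by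
    have := congrArg (Nat.cast (R := ℚ)) h2
    rw [e4] at this
    push_cast [Nat.cast_sub (by omega : a ≤ j - 1), Nat.cast_sub (by omega : 1 ≤ j),
      Nat.cast_sub (by omega : 2 * j ≤ n)] at this
    linarith
  rw [e4]
  push_cast
  calc ((n : ℚ) - 2 * j + a + 1) * a * ((j.choose a : ℚ) * ((n - j - 1).choose (j - 2 - a) : ℚ))
      = ((j.choose a : ℚ) * a) * (((n - j - 1).choose (j - 2 - a) : ℚ) * ((n : ℚ) - 2 * j + a + 1)) := by ring
    _ = ((j.choose (a - 1) : ℚ) * ((j : ℚ) + 1 - a)) *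
          (((n - j - 1).choose (j - 1 - a) : ℚ) * ((j : ℚ) - 1 - a)) := by rw [h1', h2']
    _ = ((j : ℚ) - 1 - a) * ((j : ℚ) + 1 - a) *
          ((j.choose (a - 1) : ℚ) * ((n - j - 1).choose (j - 1 - a) : ℚ)) := by ring

/-! ### The first-order recursions of the weighted certificates -/

/-- `P_a = C_{≤a}/C(n, j+1)`. -/
def cdfQ (α : Type) [Fintype α] (j a : ℕ) : ℚ :=
  (cumCount (Fintype.card α) j a : ℚ) / ((Fintype.card α).choose (j + 1) : ℕ)

/-- `(n − 2j)·λ_0·sʸ_0 = P_0` (`1 ≤ j`, `2j + 1 ≤ n`). -/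
theorem lamRec_step_zero {j : ℕ} (hj : 1 ≤ j) (hn : 2 * j + 1 ≤ Fintype.card α) :
    ((Fintype.card α : ℚ) - 2 * j) * lamRec α j 0 * sQy α j 0 = cdfQ α j 0 := by
  have h := dFlux_mul_sQy (α := α) (j := j) (a := 0) (by omega) hn
  have hj0 : (j : ℚ) ≠ 0 := by exact_mod_cast (by omega : j ≠ 0)
  have e : lamRec α j 0 = dFlux α j 0 := by
    simp only [lamRec, eDef, Nat.cast_zero, sub_zero]
    rw [mul_div_cancel_left₀ _ hj0]
  rw [e]
  unfold cdfQ
  simp only [Nat.cast_zero, add_zero] at h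
  exact h

/-- **The recursion of the weighted profile certificate**: `(n − 2j + a)·λ_a·sʸ_a + (j + 1 − a)·λ_{a−1}·sʸ_{a−1} = P_a`
for `1 ≤ a < j`, `2j + 1 ≤ n`. -/
theorem lamRec_step {j a : ℕ} (ha1 : 1 ≤ a) (ha : a < j) (hn : 2 * j + 1 ≤ Fintype.card α) :
    ((Fintype.card α : ℚ) - 2 * j + a) * lamRec α j a * sQy α j a +
      ((j : ℚ) + 1 - a) * lamRec α j (a - 1) * sQy α j (a - 1) = cdfQ α j a := by
  obtain ⟨b, rfl⟩ : ∃ b, a = b + 1 := ⟨a - 1, by omega⟩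
  have hd := dFlux_mul_sQy (α := α) (j := j) (a := b + 1) ha hn
  have hs := sQy_succ_rel (α := α) (j := j) (a := b + 1) (by omega) ha hn
  have hja : (0 : ℚ) < (j : ℚ) - b - 1 := by
    have : (b : ℚ) + 2 ≤ j := by exact_mod_cast (by omega : b + 2 ≤ j)
    linarith
  have e : lamRec α j (b + 1) = (eDef α j (b + 1) - ((b : ℚ) + 1) * lamRec α j b) / ((j : ℚ) - b - 1) := rfl
  have he : eDef α j (b + 1) = ((j : ℚ) - b - 1) * dFlux α j (b + 1) := by
    unfold eDef
    push_cast
    ring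
  unfold cdfQ
  rw [← hd, e, he]
  simp only [Nat.add_sub_cancel]
  push_cast at hs ⊢
  -- `(m)·[(j−b−1)d − (b+1)λ_b]/(j−b−1)·sʸ + (j−b)·λ_b·sʸ₋ = m·d·sʸ`, using `m·(b+1)·sʸ = (j−b−1)(j−b)·sʸ₋`
  have hm : ((Fintype.card α : ℚ) - 2 * j + (b + 1)) * ((b : ℚ) + 1) * sQy α j (b + 1) =
      ((j : ℚ) - (b + 1)) * ((j : ℚ) + 1 - (b + 1)) * sQy α j b := hs
  have e2 : (j : ℚ) - (b + 1) = (j : ℚ) - b - 1 := by ring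
  have e3 : (j : ℚ) + 1 - (b + 1) = (j : ℚ) - b := by ring
  rw [e2, e3] at hm
  rw [e3]
  field_simp
  linear_combination (-(lamRec α j b)) * hm

/-- `(n − 2j + 1)·μ_0·s'_0 = P_0` (`2 ≤ j`, `2j + 1 ≤ n`). -/
theorem muRec_step_zero {j : ℕ} (hj : 2 ≤ j) (hn : 2 * j + 1 ≤ Fintype.card α) :
    ((Fintype.card α : ℚ) - 2 * j + 1) * muRec α j 0 * sQ' α j 0 = cdfQ α j 0 := by
  have h := gDef_mul_sQ' (α := α) (j := j) (a := 0) (by omega) hn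
  have hne : (j : ℚ) - 1 ≠ 0 := by
    have : (2 : ℚ) ≤ j := by exact_mod_cast hj
    linarith
  have e : muRec α j 0 = gDef α j 0 / ((j : ℚ) - 1) := rfl
  rw [e]
  unfold cdfQ
  simp only [Nat.cast_zero, add_zero, sub_zero] at h ⊢
  have e2 : ((Fintype.card α : ℚ) - 2 * j + 1) * (gDef α j 0 / ((j : ℚ) - 1)) * sQ' α j 0 =
      (((Fintype.card α : ℚ) - 2 * j + 1) * gDef α j 0 * sQ' α j 0) / ((j : ℚ) - 1) := by ring
  rw [e2, h, mul_div_cancel_left₀ _ hne]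

/-- **The recursion of the weighted through-point certificate**:
`(n − 2j + a + 1)·μ_a·s'_a + (j + 1 − a)·μ_{a−1}·s'_{a−1} = P_a` for `1 ≤ a`, `a + 2 ≤ j`, `2j + 1 ≤ n`. -/
theorem muRec_step {j a : ℕ} (ha1 : 1 ≤ a) (ha : a + 2 ≤ j) (hn : 2 * j + 1 ≤ Fintype.card α) :
    ((Fintype.card α : ℚ) - 2 * j + a + 1) * muRec α j a * sQ' α j a +
      ((j : ℚ) + 1 - a) * muRec α j (a - 1) * sQ' α j (a - 1) = cdfQ α j a := by
  obtain ⟨b, rfl⟩ : ∃ b, a = b + 1 := ⟨a - 1, by omega⟩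
  have hd := gDef_mul_sQ' (α := α) (j := j) (a := b + 1) ha hn
  have hs := sQ'_succ_rel (α := α) (j := j) (a := b + 1) (by omega) ha hn
  have hja : (0 : ℚ) < (j : ℚ) - b - 2 := by
    have : (b : ℚ) + 3 ≤ j := by exact_mod_cast (by omega : b + 3 ≤ j)
    linarith
  have e : muRec α j (b + 1) = (gDef α j (b + 1) - ((b : ℚ) + 1) * muRec α j b) / ((j : ℚ) - b - 2) := rfl
  unfold cdfQ
  simp only [Nat.add_sub_cancel]
  push_cast at hd hs ⊢
  have e2 : (j : ℚ) - 1 - (b + 1) = (j : ℚ) - b - 2 := by ring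
  rw [e2] at hd hs
  have e3 : (j : ℚ) + 1 - (b + 1) = (j : ℚ) - b := by ring
  rw [e3] at hs
  -- from `hd`: `P = m·g·s'/(j−b−2)`
  have hP : (cumCount (Fintype.card α) j (b + 1) : ℚ) / ((Fintype.card α).choose (j + 1) : ℕ) =
      ((Fintype.card α : ℚ) - 2 * j + (b + 1) + 1) * gDef α j (b + 1) * sQ' α j (b + 1) / ((j : ℚ) - b - 2) := by
    rw [eq_div_iff hja.ne']
    linarith [hd]
  rw [hP, e]
  field_simp
  linear_combination (-(muRec α j b)) * hs

end PercRepro.PuncturedLYM
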